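import Literature.NumberTheory.Rogawski1990.ArchBouazizWallSetRepresentation      -- ★ p851224 (this seat): ED. 1 head `exists_wallSet_representation`, `pi_compl_null_of_forall`, `sin_wallAngle_ne_zero_of_circleExp_ne`
import Literature.NumberTheory.Rogawski1990.ArchBouazizStableFamilyJumpZeroProduct    -- ★ (LH10-p02 (g4)): `endoTorus_snd_eq_of_forall_apply_one` (the `U(Φ₁)`-part reads slot 1 only)
import HarnessLib

/-!
# THE WALL-SET REPRESENTATION, NORMAL-LINE EDITION: the curried integrand `g` is CONSTANT along the wall normals `c ↦ c + s • nrm w` (`w ∈ P₀`)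
# (stage (JH-C1) of `JH-SPEC.v1.md`: the jump clause (J) for `stOrbFamH`, all orders; Shelstad 1979 §4, Bouaziz 1994 §3.2 (I₃))

Topic `NumberTheory/Rogawski1990`; namespace `Literature.NumberTheory.Rogawski1990`.  THEOREMS ONLY (no `def`, no instance, no axiom, no `sorry`).  Cell `pub/hodgecm-mathlib`,
crux H413 (`stmt-HodgeConjecture-24833`), line LH3 (closer stub `stub_N9`, DIRECT ROAD), letter L3′ forward half = the jump clause (J) `ArchBzJump jcH (stOrbFamH L νH fH)` after ★ p851279.
Author LH3-p01 (g5).  Count-neutral.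

WHAT.  ★ `exists_wallSet_representation` (ED. 1) exports `I(c) = ℓ(∫ g(c, (↑↑(h_i T_i(ψ_i(c)) h_i⁻¹))_i) d(⊗ν))` with `g` jointly `C^∞` of uniform compact matrix support.  For the JUMP along the
normal ray `ν ↦ p + ν • nrm w₀` one needs that the ONLY `ν`-dependence is through the angle `ψ_{w₀}`: the same construction gives
**`exists_wallSet_representation_normal`** = ED. 1's conclusion AND `∀ c (i ∈ P₀) s Y, g (c + s • nrm i, Y) = g (c, Y)` (the model reads `c` at a wall place only through the centre
`(c₀+c₂)/2` and the `U(Φ₁)`-slot `c₁`, both constant along `nrm = e₀ − e₂`: ★ `exists_clm_ambient_endoEmbArch_sub_eq_sum` moves the `w₀`-block of `ι_∞(γ_S(c))` into `Λ_{w₀}`, where it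
cancels).  Consequence: along the normal ray the compact-side functional is `ν ↦ u(p + ν nrm) · ℓ(F(ν, p))` with the engine's joint functional `F` at the FIXED parameter `p`.
HONEST LABEL: HC_CM is proved only modulo the 7 printed citations (2 remaining: hLiu418 = stmt-HodgeConjecture-24832, h413 = stmt-HodgeConjecture-24833) until rung 0 closes; bookkeeping.

## References
* [Shelstad1979] D. Shelstad, *Characters and inner forms of a quasi-split group over ℝ*, Compositio Math. 39 (1979), §4 Lemma 4.3 p. 25, Prop. 4.5 p. 26.
* [Bouaziz1994IntegralesOrbitales] A. Bouaziz, *Intégrales orbitales sur les algèbres de Lie réductives*, Invent. Math. 115 (1994), §3.2 (I₃) p. 580; §6.2 p. 591.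
* [Varadarajan1989] V. S. Varadarajan, *An Introduction to Harmonic Analysis on Semisimple Lie Groups*, Cambridge Stud. Adv. Math. 16 (1989), §6.4 Lemma 21, Thm 23.
* [Rogawski1990] J. D. Rogawski, *Automorphic Representations of Unitary Groups in Three Variables*, Ann. of Math. Stud. 123 (1990), §4.8 p. 53; §8.2 p. 122.
-/

set_option autoImplicit false

noncomputable section

open MeasureTheory Measure Filter Topology Set Function NumberField NumberField.InfinitePlace NumberField.mixedEmbedding Matrix Complex BoundedContinuousFunction
open Literature.NumberTheory.Automorphic Literature.NumberTheory.Automorphic.UnitaryGroup Literature.NumberTheory.Automorphic.ArchCartan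
open scoped ContDiff MatrixGroups Matrix Classical ENNReal NNReal
open scoped Matrix.Norms.Operator

namespace Literature.NumberTheory.Rogawski1990

local notation3 "Φ₂[" L "]" => (Matrix.of fun i j : Fin 2 => if i.val + j.val + 1 = 2 then (1 : L) else 0)
local notation3 "Φ₁[" L "]" => (Matrix.of fun i j : Fin 1 => if i.val + j.val + 1 = 1 then (1 : L) else 0)
local notation3 "𝔸[" L "]" => ↥(arch (↥(maximalRealSubfield L)) L (IsCMField.complexConj L) 2 Φ₂[L])
local notation3 "𝔹[" L "]" => ↥(arch (↥(maximalRealSubfield L)) L (IsCMField.complexConj L) 1 Φ₁[L])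

/-! ## The wall-set representation with the normal-line clause -/

section Representation

variable (L : Type) [Field L] [NumberField L] [IsCMField L] (S : Finset {w : InfinitePlace L // IsComplex w})
  [∀ w : {w : InfinitePlace L // IsComplex w}, MeasurableSpace ↥(archLocal L 2 Φ₂[L] w)]
  [∀ w : {w : InfinitePlace L // IsComplex w}, BorelSpace ↥(archLocal L 2 Φ₂[L] w)]

set_option maxHeartbeats 800000 in
/-- **THE WALL-SET REPRESENTATION OF THE PI-LEAF INTEGRAL, NORMAL-LINE EDITION** (★ ED. 1 + the clause `g (c + s • nrm i, Y) = g (c, Y)` for `i ∈ P₀`).  Let `fH = Θ ∘ ↑↑ι_∞` with `Θ ∈ C_c^∞(M₃(L ⊗ ℝ))` (★ `ArchSmooth₂.exists_contDiff`), leaves `Λ_w` finite on compacta, σ-finite,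
carried by closed `Z_w`, EXPLICIT at the compact places (`Λ_w = (g ↦ (g,1))_* ν_w`, `w ∉ S`, `ν_w` Haar) and UNIFORMLY PROPER (the clauses of ★ p850992), `P₀ ⊆ Sᶜ` a set of compact
places (the walls of a base point), `m : places → ℤ` (the slab shifts), and `C₁` a compact set of coordinates regular at the compact places off `P₀`.  Then there are a compact
`𝒮 ⊆ Π_{w∉P₀}(U(Φ₂)_w × U(Φ₂)_w)`, a compact `K ⊆ (P₀ → M₂(ℂ))`, a jointly `C^∞` `g : V × (P₀ → M₂(ℂ)) → (↥𝒮 →ᵇ ℂ)` with `g(c, Y) = 0` for `Y ∉ K` and every `c`, and a continuous linear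
`ℓ : (↥𝒮 →ᵇ ℂ) →L[ℝ] ℂ` with, for every `c ∈ C₁ ∩ InRegS S`,
`∫ fH(eA⁻¹(z_{w,1} γ_w(c) z_{w,2} z_{w,1}⁻¹)_w, b(c)) d(⊗Λ) = ℓ(∫_{Π_{i∈P₀} U(Φ₂)_i} g(c, (↑↑(h_i · P t_1(ψ_i(c)) P⁻¹ · h_i⁻¹))_i) d(⊗_i ν_i))`, `ψ_i(c) = (c_i0 − c_i2)/2 − m_iπ`.
[cite: Varadarajan1989, §6.4 Lemma 21, Thm 23] [cite: Bouaziz1994IntegralesOrbitales, §3.1 (I₂) p. 579] [cite: Rogawski1990, §4.8 p. 53; §8.2 p. 122] [cite: Folland1995, §2.6 (2.52)]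
[cite: HormanderALPDO1, §1.1 Thms. 1.1.6–1.1.9] -/
theorem exists_wallSet_representation_normal {fH : 𝔸[L] × 𝔹[L] → ℂ} (hfc : HasCompactSupport fH) {Θ : Matrix (Fin 3) (Fin 3) (mixedSpace L) → ℂ} (hΘ : ContDiff ℝ ∞ Θ)
    (hΘf : ∀ k, fH k = Θ (((endoEmbArch L k).val : GL (Fin 3) (mixedSpace L)) : Matrix (Fin 3) (Fin 3) (mixedSpace L)))
    (νw : ∀ w : {w : InfinitePlace L // IsComplex w}, Measure ↥(archLocal L 2 Φ₂[L] w)) [∀ w, (νw w).IsHaarMeasure]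
    (Λw : ∀ w : {w : InfinitePlace L // IsComplex w}, Measure (↥(archLocal L 2 Φ₂[L] w) × ↥(archLocal L 2 Φ₂[L] w))) [∀ w, IsFiniteMeasureOnCompacts (Λw w)]
    [∀ w, SigmaFinite (Λw w)]
    (Zw : ∀ w : {w : InfinitePlace L // IsComplex w}, Set (↥(archLocal L 2 Φ₂[L] w) × ↥(archLocal L 2 Φ₂[L] w))) (hZcl : ∀ w, IsClosed (Zw w)) (hZnull : ∀ w, Λw w (Zw w)ᶜ = 0)
    (hexpl : ∀ w, w ∉ S → Λw w = Measure.map (fun g : ↥(archLocal L 2 Φ₂[L] w) => (g, (1 : ↥(archLocal L 2 Φ₂[L] w)))) (νw w))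
    (hprop : ∀ (w) (U : Set ({w : InfinitePlace L // IsComplex w} → Fin 3 → ℝ)), IsCompact U → (w ∉ S → ∀ c ∈ U, Circle.exp (c w 0) ≠ Circle.exp (c w 2)) →
      ∀ C' : Set ↥(archLocal L 2 Φ₂[L] w), IsCompact C' →
        ∃ 𝒮 : Set (↥(archLocal L 2 Φ₂[L] w) × ↥(archLocal L 2 Φ₂[L] w)), IsCompact 𝒮 ∧
          ∀ z ∈ Zw w, ∀ c ∈ U, z.1 * (endoBlockAt L S w (c w) * z.2) * z.1⁻¹ ∈ C' → z ∈ 𝒮)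
    (P₀ : Finset {w : InfinitePlace L // IsComplex w}) (hP₀ : ∀ w ∈ P₀, w ∉ S) (m : {w : InfinitePlace L // IsComplex w} → ℤ)
    {C₁ : Set ({w : InfinitePlace L // IsComplex w} → Fin 3 → ℝ)} (hC₁ : IsCompact C₁)
    (hC₁reg : ∀ c ∈ C₁, ∀ w, w ∉ S → w ∉ P₀ → Circle.exp (c w 0) ≠ Circle.exp (c w 2)) :
    ∃ (𝒮 : Set (∀ w : {w : {w : InfinitePlace L // IsComplex w} // w ∉ P₀}, ↥(archLocal L 2 Φ₂[L] w.1) × ↥(archLocal L 2 Φ₂[L] w.1)))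
      (K : Set (↥P₀ → Matrix (Fin 2) (Fin 2) ℂ))
      (g : ({w : InfinitePlace L // IsComplex w} → Fin 3 → ℝ) × (↥P₀ → Matrix (Fin 2) (Fin 2) ℂ) → (↥𝒮 →ᵇ ℂ)) (ℓ : (↥𝒮 →ᵇ ℂ) →L[ℝ] ℂ),
      IsCompact 𝒮 ∧ IsCompact K ∧ ContDiff ℝ ∞ g ∧ (∀ c Y, Y ∉ K → g (c, Y) = 0) ∧
      (∀ (c : {w : InfinitePlace L // IsComplex w} → Fin 3 → ℝ) (i : ↥P₀) (s : ℝ) (Y : ↥P₀ → Matrix (Fin 2) (Fin 2) ℂ), g (c + s • nrm i.1, Y) = g (c, Y)) ∧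
      ∀ c ∈ C₁ ∩ InRegS S,
        (∫ z : ∀ w : {w : InfinitePlace L // IsComplex w}, ↥(archLocal L 2 Φ₂[L] w) × ↥(archLocal L 2 Φ₂[L] w),
          fH ((archPiEquivCM 2 L Φ₂[L]).symm (fun w => (z w).1 * (endoBlockAt L S w (c w) * (z w).2) * (z w).1⁻¹), (endoTorus L S c).2) ∂(Measure.pi Λw)) =
        ℓ (∫ h : (∀ i : ↥P₀, ↥(archLocal L 2 Φ₂[L] i.1)),
          g (c, fun i => (((h i * ⟨Matrix.GeneralLinearGroup.mkOfDetNeZero !![(1 : ℂ), 1; 1, -1] det_cayleyTwo_ne_zero *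
              circleDiagonal 2 ![1 * Circle.exp ((c i.1 0 - c i.1 2) / 2 - m i.1 * Real.pi), 1 * Circle.exp (-((c i.1 0 - c i.1 2) / 2 - m i.1 * Real.pi))] *
              (Matrix.GeneralLinearGroup.mkOfDetNeZero !![(1 : ℂ), 1; 1, -1] det_cayleyTwo_ne_zero)⁻¹, cayley_conj_circleDiagonal_mem_archLocal L i.1 _⟩ * (h i)⁻¹ :
            ↥(archLocal L 2 Φ₂[L] i.1)) : GL (Fin 2) ℂ) : Matrix (Fin 2) (Fin 2) ℂ)) ∂(Measure.pi fun i : ↥P₀ => νw i.1)) := by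
  haveI : ∀ w : {w : InfinitePlace L // IsComplex w}, LocallyCompactSpace ↥(archLocal L 2 Φ₂[L] w) := fun w => locallyCompactSpace_archLocal_two L w
  haveI : ∀ w : {w : InfinitePlace L // IsComplex w}, SecondCountableTopology ↥(archLocal L 2 Φ₂[L] w) := fun w => secondCountableTopology_archLocal_two L w
  have hf : Continuous fH := by
    have h : fH = fun k => Θ (((endoEmbArch L k).val : GL (Fin 3) (mixedSpace L)) : Matrix (Fin 3) (Fin 3) (mixedSpace L)) := funext hΘf
    rw [h]
    exact hΘ.continuous.comp (Units.continuous_val.comp (continuous_subtype_val.comp (continuous_endoEmbArch L)))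
  -- abbreviations: the torus curves at the places of `P₀`, the angle `ψ_i(c)`, the centre `u_i(c)`
  set T : ∀ i : ↥P₀, ℝ → ↥(archLocal L 2 Φ₂[L] i.1) := fun i ψ => ⟨Matrix.GeneralLinearGroup.mkOfDetNeZero !![(1 : ℂ), 1; 1, -1] det_cayleyTwo_ne_zero *
      circleDiagonal 2 ![1 * Circle.exp ψ, 1 * Circle.exp (-ψ)] * (Matrix.GeneralLinearGroup.mkOfDetNeZero !![(1 : ℂ), 1; 1, -1] det_cayleyTwo_ne_zero)⁻¹,
      cayley_conj_circleDiagonal_mem_archLocal L i.1 _⟩ with hT_def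
  set ψf : ↥P₀ → ({w : InfinitePlace L // IsComplex w} → Fin 3 → ℝ) → ℝ := fun i c => (c i.1 0 - c i.1 2) / 2 - m i.1 * Real.pi with hψf_def
  -- (1) the multi-place update maps `Λ_w`
  obtain ⟨Λ, -, hΛ⟩ := exists_clm_ambient_endoEmbArch_sub_eq_sum L
  -- (2) the shadows of the support of `fH` at every place, and the compact `𝒮` of relevant outer leaves over `C₁`
  have hCw : ∀ w : {w : InfinitePlace L // IsComplex w}, IsCompact ((fun k : 𝔸[L] × 𝔹[L] => archPiEquivCM 2 L Φ₂[L] k.1 w) '' tsupport fH) :=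
    fun w => hfc.image ((continuous_apply w).comp ((archPiEquivCM 2 L Φ₂[L]).continuous.comp continuous_fst))
  have h𝒮w : ∀ j : {w : {w : InfinitePlace L // IsComplex w} // w ∉ P₀}, ∃ 𝒮j : Set (↥(archLocal L 2 Φ₂[L] j.1) × ↥(archLocal L 2 Φ₂[L] j.1)), IsCompact 𝒮j ∧
      ∀ z ∈ Zw j.1, ∀ c ∈ C₁, z.1 * (endoBlockAt L S j.1 (c j.1) * z.2) * z.1⁻¹ ∈ (fun k : 𝔸[L] × 𝔹[L] => archPiEquivCM 2 L Φ₂[L] k.1 j.1) '' tsupport fH → z ∈ 𝒮j :=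
    fun j => hprop j.1 C₁ hC₁ (fun hjS c hc => hC₁reg c hc j.1 hjS j.2) _ (hCw j.1)
  choose 𝒮w h𝒮wc h𝒮w using h𝒮w
  set 𝒮 : Set (∀ w : {w : {w : InfinitePlace L // IsComplex w} // w ∉ P₀}, ↥(archLocal L 2 Φ₂[L] w.1) × ↥(archLocal L 2 Φ₂[L] w.1)) := Set.pi univ 𝒮w with h𝒮_def
  have h𝒮c : IsCompact 𝒮 := isCompact_univ_pi h𝒮wc
  haveI : CompactSpace ↥𝒮 := isCompact_iff_compactSpace.1 h𝒮c
  -- (3) the shadows in `M₂(ℂ)`, circle-saturated: the compact `K₀` containing every relevant matrix tuple, and the cutoff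
  have hce : ∀ w : {w : InfinitePlace L // IsComplex w}, IsClosedEmbedding (fun y : ↥(archLocal L 2 Φ₂[L] w) => ((y : GL (Fin 2) ℂ) : Matrix (Fin 2) (Fin 2) ℂ)) := fun w =>
    isClosedEmbedding_coe_unitaryGroupOfForm_of_eq_over (by rw [Literature.NumberTheory.Rogawski1990.antidiagOne_map, StdForm.over_antidiagonal_eq])
  set Kw : ∀ i : ↥P₀, Set (Matrix (Fin 2) (Fin 2) ℂ) := fun i => (fun p : Circle × Matrix (Fin 2) (Fin 2) ℂ => ((p.1 : ℂ) • p.2)) ''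
    (univ ×ˢ ((fun y : ↥(archLocal L 2 Φ₂[L] i.1) => ((y : GL (Fin 2) ℂ) : Matrix (Fin 2) (Fin 2) ℂ)) '' ((fun k : 𝔸[L] × 𝔹[L] => archPiEquivCM 2 L Φ₂[L] k.1 i.1) '' tsupport fH))) with hKw_def
  have hKwc : ∀ i, IsCompact (Kw i) := fun i =>
    ((isCompact_univ : IsCompact (univ : Set Circle)).prod ((hCw i.1).image (hce i.1).continuous)).image
      ((continuous_subtype_val.comp continuous_fst).smul continuous_snd)
  have hK₀c : IsCompact (Set.pi univ Kw) := isCompact_univ_pi hKwc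
  haveI : FiniteDimensional ℝ (Matrix (Fin 2) (Fin 2) ℂ) := Module.Finite.matrix
  obtain ⟨R, hR⟩ := hK₀c.isBounded.subset_closedBall (0 : ↥P₀ → Matrix (Fin 2) (Fin 2) ℂ)
  let χ : ContDiffBump (0 : ↥P₀ → Matrix (Fin 2) (Fin 2) ℂ) := ⟨max R 1, max R 1 + 1, lt_max_of_lt_right one_pos, lt_add_one _⟩
  have hχ1 : ∀ Y ∈ Set.pi univ Kw, χ Y = 1 := fun Y hY =>
    χ.one_of_mem_closedBall (Metric.closedBall_subset_closedBall (le_max_left _ _) (hR hY))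
  have hχ0 : ∀ Y, Y ∉ Metric.closedBall (0 : ↥P₀ → Matrix (Fin 2) (Fin 2) ℂ) (max R 1 + 1) → χ Y = 0 := fun Y hY =>
    χ.zero_of_le_dist (by rw [Metric.mem_closedBall] at hY; exact le_of_lt (not_le.1 hY))
  -- (4) the jointly smooth ambient model times the cutoff, and its reading map on `𝒮`
  set Φm : ({w : InfinitePlace L // IsComplex w} → Matrix (Fin 2) (Fin 2) ℂ × Matrix (Fin 2) (Fin 2) ℂ) ×
      (({w : InfinitePlace L // IsComplex w} → Fin 3 → ℝ) × (↥P₀ → Matrix (Fin 2) (Fin 2) ℂ)) → ℂ := fun q =>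
    ((χ q.2.2 : ℝ) : ℂ) *
      Θ ((((endoEmbArch L (endoTorus L S q.2.1)).val : GL (Fin 3) (mixedSpace L)) : Matrix (Fin 3) (Fin 3) (mixedSpace L)) +
        ∑ i : ↥P₀, Λ i.1 ((((Circle.exp ((q.2.1 i.1 0 + q.2.1 i.1 2) / 2 + m i.1 * Real.pi) : Circle) : ℂ) • q.2.2 i : Matrix (Fin 2) (Fin 2) ℂ) -
          ((endoBlock L S q.2.1 i.1 : GL (Fin 2) ℂ) : Matrix (Fin 2) (Fin 2) ℂ)) +
        ∑ w ∈ Finset.univ.filter (fun w => w ∉ P₀), Λ w ((q.1 w).1 * ((endoBlock L S q.2.1 w : GL (Fin 2) ℂ) : Matrix (Fin 2) (Fin 2) ℂ) * (q.1 w).2 -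
          ((endoBlock L S q.2.1 w : GL (Fin 2) ℂ) : Matrix (Fin 2) (Fin 2) ℂ))) with hΦm_def
  have hΦm : ContDiff ℝ ∞ Φm := by
    refine ContDiff.mul ?_ (contDiff_wallSetAmbientModel L S P₀ m hΘ Λ)
    exact ofRealCLM.contDiff.comp (χ.contDiff.comp (contDiff_snd.comp contDiff_snd))
  set ιm : ↥𝒮 → ({w : InfinitePlace L // IsComplex w} → Matrix (Fin 2) (Fin 2) ℂ × Matrix (Fin 2) (Fin 2) ℂ) := fun s w =>
    if hw : w ∈ P₀ then ((1 : Matrix (Fin 2) (Fin 2) ℂ), (1 : Matrix (Fin 2) (Fin 2) ℂ))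
    else (((((s.1 ⟨w, hw⟩).1 : ↥(archLocal L 2 Φ₂[L] w)) : GL (Fin 2) ℂ) : Matrix (Fin 2) (Fin 2) ℂ),
      ((((s.1 ⟨w, hw⟩).2 * ((s.1 ⟨w, hw⟩).1)⁻¹ : ↥(archLocal L 2 Φ₂[L] w)) : GL (Fin 2) ℂ) : Matrix (Fin 2) (Fin 2) ℂ)) with hιm_def
  have hιm : Continuous ιm := by
    refine continuous_pi fun w => ?_
    by_cases hw : w ∈ P₀
    · simp only [hιm_def, dif_pos hw]; exact continuous_const
    · simp only [hιm_def, dif_neg hw]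
      have hj : Continuous fun s : ↥𝒮 => s.1 ⟨w, hw⟩ := (continuous_apply _).comp continuous_subtype_val
      exact ((hce w).continuous.comp (continuous_fst.comp hj)).prodMk ((hce w).continuous.comp ((continuous_snd.comp hj).mul (continuous_fst.comp hj).inv))
  -- the curried family `g`
  have hgc : ∀ x : ({w : InfinitePlace L // IsComplex w} → Fin 3 → ℝ) × (↥P₀ → Matrix (Fin 2) (Fin 2) ℂ), Continuous fun s : ↥𝒮 => Φm (ιm s, x) := fun x =>
    hΦm.continuous.comp (hιm.prodMk continuous_const)
  set g : ({w : InfinitePlace L // IsComplex w} → Fin 3 → ℝ) × (↥P₀ → Matrix (Fin 2) (Fin 2) ℂ) → (↥𝒮 →ᵇ ℂ) := fun x =>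
    BoundedContinuousFunction.mkOfCompact ⟨fun s => Φm (ιm s, x), hgc x⟩ with hg_def
  have hg_apply : ∀ x s, g x s = Φm (ιm s, x) := fun _ _ => rfl
  have hg : ContDiff ℝ ∞ g := Literature.Analysis.Calculus.contDiff_curry_of_contDiff hΦm hιm hg_apply
  have hg0 : ∀ c Y, Y ∉ Metric.closedBall (0 : ↥P₀ → Matrix (Fin 2) (Fin 2) ℂ) (max R 1 + 1) → g (c, Y) = 0 := by
    intro c Y hY
    ext s
    rw [hg_apply, BoundedContinuousFunction.coe_zero, Pi.zero_apply, hΦm_def]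
    simp only
    rw [hχ0 Y hY, Complex.ofReal_zero, zero_mul]
  -- (5) the averaging functional on the compact `𝒮`
  have h𝒮meas : MeasurableSet 𝒮 := h𝒮c.isClosed.measurableSet
  set ρ : Measure ↥𝒮 := Measure.comap Subtype.val (Measure.pi fun w : {w : {w : InfinitePlace L // IsComplex w} // w ∉ P₀} => Λw w.1) with hρ_def
  haveI : IsFiniteMeasure ρ := ⟨by rw [hρ_def, comap_subtype_apply_univ _ h𝒮meas]; exact h𝒮c.measure_lt_top⟩
  obtain ⟨ℓ, hℓ, -⟩ := exists_integral_clm_boundedContinuousFunction (E := ℂ) ρ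
  -- (5b) `g` is constant along the wall normals: the model reads `c` at `i₀ ∈ P₀` only through the centre and slot `1`
  have hginv : ∀ (c : {w : InfinitePlace L // IsComplex w} → Fin 3 → ℝ) (i₀ : ↥P₀) (s : ℝ) (Y : ↥P₀ → Matrix (Fin 2) (Fin 2) ℂ),
      g (c + s • nrm i₀.1, Y) = g (c, Y) := by
    intro c i₀ s Y
    have hne : ∀ w, w ≠ i₀.1 → (c + s • nrm i₀.1) w = c w := fun w hw => by
      funext j; simp [nrm, Pi.single_eq_of_ne hw]
    have h1 : ∀ w, (c + s • nrm i₀.1) w 1 = c w 1 := fun w => by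
      by_cases hw : w = i₀.1
      · rw [hw]; simp [nrm]
      · rw [hne w hw]
    have hcen : ∀ i : ↥P₀, ((c + s • nrm i₀.1) i.1 0 + (c + s • nrm i₀.1) i.1 2) / 2 + m i.1 * Real.pi = (c i.1 0 + c i.1 2) / 2 + m i.1 * Real.pi := by
      intro i
      by_cases hi : i.1 = i₀.1
      · rw [hi]; simp [nrm]; ring
      · rw [hne i.1 hi]
    have hblk : ∀ w, w ≠ i₀.1 → endoBlock L S (c + s • nrm i₀.1) w = endoBlock L S c w := fun w hw => by
      rw [endoBlock_eq_endoBlockAt, endoBlock_eq_endoBlockAt, hne w hw]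
    -- the ambient torus point moves by `Λ_{i₀}(Δγ_{i₀})`
    have hγ' : ∀ c' : {w : InfinitePlace L // IsComplex w} → Fin 3 → ℝ, (archPiEquivCM 2 L Φ₂[L]).symm (fun w => endoBlock L S c' w) = (endoTorus L S c').1 := fun c' => by
      rw [ContinuousMulEquiv.symm_apply_eq]
      funext w
      exact (archPiEquivCM_endoTorus_fst L S c' w).symm
    have hamb : (((endoEmbArch L (endoTorus L S (c + s • nrm i₀.1))).val : GL (Fin 3) (mixedSpace L)) : Matrix (Fin 3) (Fin 3) (mixedSpace L)) =
        (((endoEmbArch L (endoTorus L S c)).val : GL (Fin 3) (mixedSpace L)) : Matrix (Fin 3) (Fin 3) (mixedSpace L)) +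
          Λ i₀.1 (((endoBlock L S (c + s • nrm i₀.1) i₀.1 : GL (Fin 2) ℂ) : Matrix (Fin 2) (Fin 2) ℂ) - ((endoBlock L S c i₀.1 : GL (Fin 2) ℂ) : Matrix (Fin 2) (Fin 2) ℂ)) := by
      have hb : (endoTorus L S (c + s • nrm i₀.1)).2 = (endoTorus L S c).2 := endoTorus_snd_eq_of_forall_apply_one L S S h1
      have h := hΛ (fun w => endoBlock L S c w) (fun w => endoBlock L S (c + s • nrm i₀.1) w) (endoTorus L S c).2
      rw [hγ', hγ', ← hb, Prod.mk.eta, hb, Prod.mk.eta] at h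
      rw [h, Finset.sum_eq_single i₀.1 (fun w _ hw => by rw [hblk w hw, sub_self, map_zero]) (fun h' => absurd (Finset.mem_univ _) h')]
    ext x
    rw [hg_apply, hg_apply, hΦm_def]
    simp only
    congr 2
    rw [hamb, Finset.sum_congr rfl fun i _ => by rw [hcen i],
      Finset.sum_congr rfl fun w (hw : w ∈ Finset.univ.filter fun w => w ∉ P₀) => by
        rw [hblk w (fun h => (Finset.mem_filter.1 hw).2 (h ▸ i₀.2))]]
    -- the `i₀`-term absorbs the shift of the ambient point
    have hsplit : ∀ c' : {w : InfinitePlace L // IsComplex w} → Fin 3 → ℝ,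
        ∑ i : ↥P₀, Λ i.1 ((((Circle.exp ((c i.1 0 + c i.1 2) / 2 + m i.1 * Real.pi) : Circle) : ℂ) • Y i : Matrix (Fin 2) (Fin 2) ℂ) -
          ((endoBlock L S c' i.1 : GL (Fin 2) ℂ) : Matrix (Fin 2) (Fin 2) ℂ)) =
        ∑ i : ↥P₀, Λ i.1 ((((Circle.exp ((c i.1 0 + c i.1 2) / 2 + m i.1 * Real.pi) : Circle) : ℂ) • Y i : Matrix (Fin 2) (Fin 2) ℂ)) -
          ∑ i : ↥P₀, Λ i.1 (((endoBlock L S c' i.1 : GL (Fin 2) ℂ) : Matrix (Fin 2) (Fin 2) ℂ)) := fun c' => by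
      rw [← Finset.sum_sub_distrib]
      exact Finset.sum_congr rfl fun i _ => by rw [map_sub]
    have hγsum : ∑ i : ↥P₀, Λ i.1 (((endoBlock L S (c + s • nrm i₀.1) i.1 : GL (Fin 2) ℂ) : Matrix (Fin 2) (Fin 2) ℂ)) =
        ∑ i : ↥P₀, Λ i.1 (((endoBlock L S c i.1 : GL (Fin 2) ℂ) : Matrix (Fin 2) (Fin 2) ℂ)) +
          Λ i₀.1 (((endoBlock L S (c + s • nrm i₀.1) i₀.1 : GL (Fin 2) ℂ) : Matrix (Fin 2) (Fin 2) ℂ) - ((endoBlock L S c i₀.1 : GL (Fin 2) ℂ) : Matrix (Fin 2) (Fin 2) ℂ)) := by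
      rw [map_sub, ← Finset.sum_erase_add _ _ (Finset.mem_univ i₀), ← Finset.sum_erase_add _ _ (Finset.mem_univ i₀)]
      rw [Finset.sum_congr rfl fun i (hi : i ∈ Finset.univ.erase i₀) => by
        rw [hblk i.1 (fun h => (Finset.mem_erase.1 hi).1 (Subtype.ext h))]]
      abel
    rw [hsplit, hsplit, hγsum]
    abel
  refine ⟨𝒮, Metric.closedBall 0 (max R 1 + 1), g, ℓ, h𝒮c, isCompact_closedBall _ _, hg, hg0, hginv, fun c hc => ?_⟩
  -- (6) the identity at `c ∈ C₁ ∩ InRegS S`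
  obtain ⟨hcC, hcI⟩ := hc
  have hreg : ∀ w, w ∉ S → Circle.exp (c w 0) ≠ Circle.exp (c w 2) := (mem_inRegS_iff S c).1 hcI
  -- (6a) Fubini: the places of `P₀` integrated out first
  have hfub := integral_unfoldIntegrand_eq_integral_integral L S fH hf hfc Λw Zw hZcl hZnull νw (fun w => w ∈ P₀) (fun w hw => hexpl w (hP₀ w hw)) c
    (fun w C' hC' => by
      obtain ⟨𝒮', h𝒮', h⟩ := hprop w {c} isCompact_singleton (fun hw c' hc' => by rw [Set.mem_singleton_iff.1 hc']; exact hreg w hw) C' hC'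
      exact ⟨𝒮', h𝒮', fun z hz hzC => h z hz c (Set.mem_singleton c) hzC⟩) (endoTorus L S c).2
  rw [hfub]
  -- (6b) the reading of the inner integrand through `g`
  have hY : ∀ (h : ∀ i : ↥P₀, ↥(archLocal L 2 Φ₂[L] i.1)) (i : ↥P₀),
      (((h i * endoBlockAt L S i.1 (c i.1) * (h i)⁻¹ : ↥(archLocal L 2 Φ₂[L] i.1)) : GL (Fin 2) ℂ) : Matrix (Fin 2) (Fin 2) ℂ) =
        ((Circle.exp ((c i.1 0 + c i.1 2) / 2 + m i.1 * Real.pi) : Circle) : ℂ) •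
          (((h i * T i (ψf i c) * (h i)⁻¹ : ↥(archLocal L 2 Φ₂[L] i.1)) : GL (Fin 2) ℂ) : Matrix (Fin 2) (Fin 2) ℂ) :=
    fun h i => coe_conj_endoBlockAt_eq_smul L S i.1 (hP₀ i.1 i.2) c (m i.1) (h i)
  have hread : ∀ (s : ↥𝒮) (h : ∀ i : ↥P₀, ↥(archLocal L 2 Φ₂[L] i.1)),
      fH ((archPiEquivCM 2 L Φ₂[L]).symm (fun w => if hw : w ∈ P₀ then h ⟨w, hw⟩ * endoBlockAt L S w (c w) * (h ⟨w, hw⟩)⁻¹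
        else (s.1 ⟨w, hw⟩).1 * (endoBlockAt L S w (c w) * (s.1 ⟨w, hw⟩).2) * (s.1 ⟨w, hw⟩).1⁻¹), (endoTorus L S c).2) =
      g (c, fun i => (((h i * T i (ψf i c) * (h i)⁻¹ : ↥(archLocal L 2 Φ₂[L] i.1)) : GL (Fin 2) ℂ) : Matrix (Fin 2) (Fin 2) ℂ)) s := by
    intro s h
    have hmodel := apply_symm_wallSet_conj_eq_ambientModel L S P₀ m hP₀ hΘf Λ hΛ s.1 (ιm s) (fun w hw => by simp only [hιm_def, dif_neg hw]) h c
    rw [hg_apply, hΦm_def]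
    simp only
    rw [← hmodel]
    -- the cutoff is `1` where `fH ≠ 0`
    by_cases hzero : fH ((archPiEquivCM 2 L Φ₂[L]).symm (fun w => if hw : w ∈ P₀ then h ⟨w, hw⟩ * endoBlockAt L S w (c w) * (h ⟨w, hw⟩)⁻¹
        else (s.1 ⟨w, hw⟩).1 * (endoBlockAt L S w (c w) * (s.1 ⟨w, hw⟩).2) * (s.1 ⟨w, hw⟩).1⁻¹), (endoTorus L S c).2) = 0
    · rw [hzero, mul_zero]
    · have hmem : (fun i => (((h i * T i (ψf i c) * (h i)⁻¹ : ↥(archLocal L 2 Φ₂[L] i.1)) : GL (Fin 2) ℂ) : Matrix (Fin 2) (Fin 2) ℂ)) ∈ Set.pi univ Kw := by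
        refine Set.mem_univ_pi.2 fun i => ?_
        have hsupp := subset_tsupport fH (Function.mem_support.2 hzero)
        refine ⟨((Circle.exp ((c i.1 0 + c i.1 2) / 2 + m i.1 * Real.pi))⁻¹, _), ⟨mem_univ _, ⟨h i * endoBlockAt L S i.1 (c i.1) * (h i)⁻¹, ⟨_, hsupp, ?_⟩, rfl⟩⟩, ?_⟩
        · show archPiEquivCM 2 L Φ₂[L] ((archPiEquivCM 2 L Φ₂[L]).symm _) i.1 = _
          rw [ContinuousMulEquiv.apply_symm_apply, dif_pos i.2]
        · show (((Circle.exp ((c i.1 0 + c i.1 2) / 2 + m i.1 * Real.pi))⁻¹ : Circle) : ℂ) •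
              (((h i * endoBlockAt L S i.1 (c i.1) * (h i)⁻¹ : ↥(archLocal L 2 Φ₂[L] i.1)) : GL (Fin 2) ℂ) : Matrix (Fin 2) (Fin 2) ℂ) = _
          rw [hY h i, smul_smul, Circle.coe_inv, inv_mul_cancel₀ (Circle.coe_ne_zero _), one_smul]
      rw [hχ1 _ hmem, Complex.ofReal_one, one_mul]
  -- (6c) the inner integral at a leaf `s ∈ 𝒮` is the value at `s` of the `E`-valued integral
  have hregP : ∀ i : ↥P₀, Real.sin (ψf i c) ≠ 0 := fun i => sin_wallAngle_ne_zero_of_circleExp_ne (hreg i.1 (hP₀ i.1 i.2)) (m i.1)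
  have hint : Integrable (fun h : ∀ i : ↥P₀, ↥(archLocal L 2 Φ₂[L] i.1) =>
      g (c, fun i => (((h i * T i (ψf i c) * (h i)⁻¹ : ↥(archLocal L 2 Φ₂[L] i.1)) : GL (Fin 2) ℂ) : Matrix (Fin 2) (Fin 2) ℂ))) (Measure.pi fun i : ↥P₀ => νw i.1) := by
    -- continuous with compact support (compact conjugating sets at the regular angles `ψ_i(c)`)
    have hcont : Continuous fun h : ∀ i : ↥P₀, ↥(archLocal L 2 Φ₂[L] i.1) =>
        g (c, fun i => (((h i * T i (ψf i c) * (h i)⁻¹ : ↥(archLocal L 2 Φ₂[L] i.1)) : GL (Fin 2) ℂ) : Matrix (Fin 2) (Fin 2) ℂ)) :=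
      hg.continuous.comp (continuous_const.prodMk (continuous_pi fun i =>
        (hce i.1).continuous.comp (((continuous_apply i).mul continuous_const).mul (continuous_apply i).inv)))
    have h𝒞 : ∀ i : ↥P₀, ∃ 𝒞 : Set ↥(archLocal L 2 Φ₂[L] i.1), IsCompact 𝒞 ∧ ∀ y, ∀ ψ ∈ ({ψf i c} : Set ℝ),
        y * T i ψ * y⁻¹ ∈ (fun y : ↥(archLocal L 2 Φ₂[L] i.1) => ((y : GL (Fin 2) ℂ) : Matrix (Fin 2) (Fin 2) ℂ)) ⁻¹'
          ((fun Y : ↥P₀ → Matrix (Fin 2) (Fin 2) ℂ => Y i) '' Metric.closedBall (0 : ↥P₀ → Matrix (Fin 2) (Fin 2) ℂ) (max R 1 + 1)) → y ∈ 𝒞 := fun i => by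
      have h := exists_isCompact_forall_conj_cayleyTorus_mem_imp_mem L i.1 1 isCompact_singleton (fun ψ hψ => by rw [Set.mem_singleton_iff.1 hψ]; exact hregP i)
        ((hce i.1).isCompact_preimage ((isCompact_closedBall (0 : ↥P₀ → Matrix (Fin 2) (Fin 2) ℂ) (max R 1 + 1)).image (continuous_apply i)))
      simpa only [hT_def] using h
    choose 𝒞 h𝒞c h𝒞 using h𝒞
    refine hcont.integrable_of_hasCompactSupport (HasCompactSupport.intro (isCompact_univ_pi h𝒞c) fun h hh => ?_)
    obtain ⟨i, -, hi⟩ : ∃ i, i ∈ univ ∧ h i ∉ 𝒞 i := by simpa [Set.mem_univ_pi] using hh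
    apply hg0
    intro hK
    exact hi (h𝒞 i (h i) (ψf i c) (Set.mem_singleton _) ⟨_, hK, rfl⟩)
  have hinner : ∀ s : ↥𝒮, (∫ h : ∀ i : ↥P₀, ↥(archLocal L 2 Φ₂[L] i.1),
      fH ((archPiEquivCM 2 L Φ₂[L]).symm (fun w => if hw : w ∈ P₀ then h ⟨w, hw⟩ * endoBlockAt L S w (c w) * (h ⟨w, hw⟩)⁻¹
        else (s.1 ⟨w, hw⟩).1 * (endoBlockAt L S w (c w) * (s.1 ⟨w, hw⟩).2) * (s.1 ⟨w, hw⟩).1⁻¹), (endoTorus L S c).2) ∂(Measure.pi fun i : ↥P₀ => νw i.1)) =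
      (∫ h : ∀ i : ↥P₀, ↥(archLocal L 2 Φ₂[L] i.1),
        g (c, fun i => (((h i * T i (ψf i c) * (h i)⁻¹ : ↥(archLocal L 2 Φ₂[L] i.1)) : GL (Fin 2) ℂ) : Matrix (Fin 2) (Fin 2) ℂ)) ∂(Measure.pi fun i : ↥P₀ => νw i.1)) s := by
    intro s
    have hcomm := (BoundedContinuousFunction.evalCLM ℝ s).integral_comp_comm hint
    simp only [BoundedContinuousFunction.evalCLM_apply] at hcomm
    rw [← hcomm]
    exact integral_congr_ae (Eventually.of_forall fun h => hread s h)
  -- (6d) restriction of the outer integral to `𝒮` and the average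
  have hvan : ∀ z' ∈ Set.pi univ (fun w : {w : {w : InfinitePlace L // IsComplex w} // w ∉ P₀} => Zw w.1), z' ∉ 𝒮 →
      (∫ h : ∀ i : ↥P₀, ↥(archLocal L 2 Φ₂[L] i.1),
        fH ((archPiEquivCM 2 L Φ₂[L]).symm (fun w => if hw : w ∈ P₀ then h ⟨w, hw⟩ * endoBlockAt L S w (c w) * (h ⟨w, hw⟩)⁻¹
          else (z' ⟨w, hw⟩).1 * (endoBlockAt L S w (c w) * (z' ⟨w, hw⟩).2) * (z' ⟨w, hw⟩).1⁻¹), (endoTorus L S c).2) ∂(Measure.pi fun i : ↥P₀ => νw i.1)) = 0 := by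
    intro z' hz' hz'𝒮
    obtain ⟨j, -, hj⟩ : ∃ j, j ∈ univ ∧ z' j ∉ 𝒮w j := by simpa [h𝒮_def, Set.mem_univ_pi] using hz'𝒮
    refine integral_eq_zero_of_ae (Eventually.of_forall fun h => ?_)
    refine image_eq_zero_of_notMem_tsupport fun hmem => hj (h𝒮w j (z' j) (Set.mem_univ_pi.1 hz' j) c hcC ⟨_, hmem, ?_⟩)
    show archPiEquivCM 2 L Φ₂[L] ((archPiEquivCM 2 L Φ₂[L]).symm _) j.1 = _
    rw [ContinuousMulEquiv.apply_symm_apply, dif_neg j.2]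
  -- the `Fintype` instance on `↥P₀` inside `Measure.pi` carried by ★'s Fubini clause (`Subtype.fintype`) is irrelevant
  refine Eq.trans (integral_congr_ae (Eventually.of_forall fun z' => ?_))
    ((integral_eq_integral_subtype_of_support (Measure.pi fun w : {w : {w : InfinitePlace L // IsComplex w} // w ∉ P₀} => Λw w.1) h𝒮meas
      (pi_compl_null_of_forall _ _ fun w => hZnull w.1) hvan).trans ?_)
  · beta_reduce
    congr 1
    congr 1
    exact Subsingleton.elim _ _
  rw [hℓ]
  exact integral_congr_ae (Eventually.of_forall fun s => hinner s)

end Representation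

end Literature.NumberTheory.Rogawski1990

end
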